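import Summits.BirchSwinnertonDyer.BirchSwinnertonDyer.Theorems.AlignedTransportAtTwoMainConjectureOfRankZeroBSDAtTwoFineRoadRealKummerOrdinary
import Summits.BirchSwinnertonDyer.Rank1Residual.Additive.RamifiedOrdinaryLineUnique
import HarnessLib

/-!
# The two LETTERS along a signed `2^∞`-congruence: Greenberg's line `C_p` is matched by EVERY sign-equivariant `e : V[p^∞] ≃+ W[p^∞]`
# between good ordinary curves; the real Kummer line is matched where `e` is equivariant and sent to the anti-Kummer line where it is not

Cell `bsd-f1-sign2`, WIDTH-5 attach seat `bsd-line-att-p5` (gen 11) on line `birth` of crux C2 stmt-BirchSwinnertonDyer-22298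
`MainConjectureOfRankZeroBSDAtTwo`; sequel of att-p5 g10 `…FineRoadRealKummerOrdinary` / `…RealKummerCongruence` (successor option (v-a)
of the crux workfile `RELAXED-COEFFICIENTS-att-p5.md` §9). A `--supports 22298 --as helper` file. HONEST FRAMING: THEOREMS ONLY — no
definition, no named fact, no `sorry`; C2-NEUTRAL (stub T stays OPEN; verdict «blocked-on GreenbergMuConjectureIrreducible» untouched);
BSD is NOT proved by any of this.

WHY. att-p5 g10 proved (mod the one GV print fact) that stub T's conclusion «`X(W/ℚ_∞)` `Λ`-torsion ∧ `μ₂ = 0`» transfers along a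
`Γ_ℚ`-isomorphism `ψ : V[2] ≃ W[2]` provided `ψ` matches TWO LETTERS: the `2`-adic line `C₂ ∩ E[2]` and the real Kummer letter `T_w`.
The source of such `ψ` in nature is a SIGNED isomorphism of `2^∞`-torsion `e : V[2^∞] ≃+ W[2^∞]`, `e(σm) = ±σ e(m)` with the sign
depending on `σ` only — the twisting isomorphism of a quadratic twist `W = C • V^{(d)}` (tree
`Additive.exists_addEquiv_geomPrimaryTorsion_of_model_twist_sign`: `+` on the fixer of `√d`, `−` off it). This file proves what such an
`e` does to the letters:
* §1 (any prime `p`; `V`, `W` globally minimal, good ORDINARY at `p`) **`map_reductionDatum_plus_eq_of_signEquivariant`: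
  `e(C_p(V)) = C_p(W)` with NO condition on the signs** — `e(C_p(V))` is `p`-divisible, proper, and the SQUARE of every local inertia
  element acts trivially on the quotient (squares kill signs; X2 `reductionDatum_htriv`), so the tree's uniqueness of the ordinary line
  (`RamifiedOrdinaryLineUnique.eq_reductionDatum_plus`, Greenberg LNM 1716 p. 63 / GV p. 26 «`C` is determined by the action of `I_p`»)
  applies on `W`.
* §2 `exists_torsionIso_of_primaryIso`: `e` restricts to `ψ : V[p] ≃+ W[p]` (`ι ∘ ψ = e ∘ ι`).
* §3 (`p = 2`) `torsionIso_smul_of_signEquivariant` (`ψ` is `Γ_ℚ`-equivariant: `−t = t` on `E[2]`) and **`mem_plus_iff_of_signEquivariant`**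
  (`ψ` matches the `2`-adic letters of the data `C₂ ∩ E[2]` of `RealKummerOrdinary.exists_torsionDatum`).
* §4 **`kummerLine_iff_of_smul_eq`**: where `e` is EQUIVARIANT at `g` the Kummer line `(g−1)·V[2^∞] ∩ V[2] = {O, T_w}` goes to
  `(g−1)·W[2^∞] ∩ W[2] = {O, ψT_w}`; **`antiKummerLine_iff_of_smul_eq_neg`**: where `e` is ANTI-equivariant at `g` it goes to the
  ANTI-Kummer line `(g+1)·W[2^∞] ∩ W[2] = {O, ψT_w}` (the structural form of the workfile's OBSERVATION «the real letter flips under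
  negative twists»).
The assembly with complex conjugation and `√d` is the sibling `…FineRoadRealKummerTwist`.

References: R. Greenberg, V. Vatsal, Invent. Math. 142 (2000) Thm. 1.4, §2 p. 26; R. Greenberg, LNM 1716 (1999) §2 pp. 63, 70, §5 pp. 168,
174; M. Emerton, R. Pollack, T. Weston, Invent. Math. 163 (2006) §3.1; J. H. Silverman, *AEC* 2nd ed. (2009) III.3.1(b), III.§7, X.2
Prop. 2.4, X.5 Cor. 5.4; crux workfile `RELAXED-COEFFICIENTS-att-p5.md` §9–§10 (cell bsd-f1-sign2).
-/

set_option autoImplicit false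
-- the Theorems namespace of this sub repeats the summit name by design (D-0017 nested layout)
set_option linter.dupNamespace false

noncomputable section

open scoped Classical

namespace Summit.BirchSwinnertonDyer.BirchSwinnertonDyer.Theorems.AlignedTransportAtTwoFineRoad.RealKummerTwistLetters

open WeierstrassCurve NumberField IsDedekindDomain Field Literature.NumberTheory.EllipticCurves
  Literature.NumberTheory.EllipticCurves.GreenbergSelmer Literature.NumberTheory.GaloisRepresentations
  Summit.BirchSwinnertonDyer.BirchSwinnertonDyer.Theorems.AlignedTransportAtTwoFineRoad
  Summit.BirchSwinnertonDyer.Rank1Residual.X2 Summit.BirchSwinnertonDyer.Rank1Residual.X2.GreenbergVatsalReductionDatum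
  Summit.BirchSwinnertonDyer.Rank1Residual.Additive

/-! ## §1 Greenberg's line `C_p = ker(E[p^∞] → Ẽ)` is matched by EVERY sign-equivariant isomorphism of `p`-primary torsion
between globally minimal good ordinary curves -/

section Line

variable (V W : WeierstrassCurve ℚ) [V.IsGloballyMinimal] [V.IsElliptic] [W.IsGloballyMinimal] [W.IsElliptic]
  (p : ℕ) [hp : Fact p.Prime] {v : HeightOneSpectrum (𝓞 ℚ)}

/-- Squares are honestly equivariant for a sign-equivariant map. [folklore] -/
theorem apply_sq_smul_of_signEquivariant {M M' : Type} [AddCommGroup M] [AddCommGroup M']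
    [DistribMulAction (absoluteGaloisGroup ℚ) M] [DistribMulAction (absoluteGaloisGroup ℚ) M'] (e : M ≃+ M')
    (he : ∀ σ : absoluteGaloisGroup ℚ, (∀ m, e (σ • m) = σ • e m) ∨ (∀ m, e (σ • m) = -(σ • e m)))
    (g : absoluteGaloisGroup ℚ) (m : M) : e (g ^ 2 • m) = g ^ 2 • e m := by
  rcases he g with h | h
  · rw [pow_two, mul_smul, mul_smul, h, h]
  · rw [pow_two, mul_smul, mul_smul, h, h, smul_neg, neg_neg]

/-- **`e(C_p(V)) = C_p(W)` for every sign-equivariant `e : V[p^∞] ≃+ W[p^∞]`** between globally minimal curves that are good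
ORDINARY at `p` (`p ∤ Δ_min`, `p ∤ a_p`; `v ∋ p`): Greenberg's line «is determined by the action of `I_p`» (GV 2000 p. 26) — the
image `e(C_p(V))` is `p`-divisible, proper, and the SQUARE of every local inertia element acts trivially on `W[p^∞]/e(C_p(V))`
(squares kill the signs; `I_v` acts trivially on `V[p^∞]/C_p(V)` by X2 `reductionDatum_htriv`), so the tree's uniqueness of the
ordinary line (`RamifiedOrdinaryLineUnique.eq_reductionDatum_plus`, exponent `N = 2`) applies on `W`. No condition on the signs.
[cite: GreenbergVatsal2000, §2 p. 26] [cite: GreenbergLNM1716, §2 pp. 63, 70] -/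
theorem map_reductionDatum_plus_eq_of_signEquivariant (hpv : ((p : ℕ) : 𝓞 ℚ) ∈ v.asIdeal)
    (hΔ : ¬ (p : ℤ) ∣ minimalDiscriminantInt V) (hΔ' : ¬ (p : ℤ) ∣ minimalDiscriminantInt W)
    (hord : ¬ (p : ℤ) ∣ V.frobeniusTrace p) (hord' : ¬ (p : ℤ) ∣ W.frobeniusTrace p)
    (e : ↥(V.geomPrimaryTorsion p) ≃+ ↥(W.geomPrimaryTorsion p))
    (he : ∀ σ : absoluteGaloisGroup ℚ, (∀ m, e (σ • m) = σ • e m) ∨ (∀ m, e (σ • m) = -(σ • e m))) :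
    (reductionDatum V p hpv hΔ).plus.map e.toAddMonoidHom = (reductionDatum W p hpv hΔ').plus := by
  set X : AddSubgroup ↥(W.geomPrimaryTorsion p) := (reductionDatum V p hpv hΔ).plus.map e.toAddMonoidHom with hXdef
  have hmemX : ∀ m, e m ∈ X ↔ m ∈ (reductionDatum V p hpv hΔ).plus := fun m ↦ by
    rw [hXdef]
    constructor
    · rintro ⟨m', hm', hmm'⟩
      rw [AddEquiv.coe_toAddMonoidHom, e.injective.eq_iff] at hmm'
      exact hmm' ▸ hm'
    · exact fun hm ↦ ⟨m, hm, rfl⟩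
  have hXdiv : ∀ m' ∈ X, ∃ m₁ ∈ X, p • m₁ = m' := by
    rintro _ ⟨m, hm, rfl⟩
    obtain ⟨m₁, hm₁, hpm₁⟩ := reductionDatum_divisible V p hpv hΔ hord m hm
    exact ⟨e m₁, (hmemX m₁).2 hm₁, by rw [AddEquiv.coe_toAddMonoidHom, ← map_nsmul, hpm₁]⟩
  have hXtop : X ≠ ⊤ := by
    intro htop
    apply reductionDatum_plus_ne_top V p hpv hΔ hord
    rw [eq_top_iff]
    intro m _
    exact (hmemX m).1 (htop ▸ AddSubgroup.mem_top _)
  have hXN : ∃ N : ℕ, 0 < N ∧ ∀ σ ∈ absInertia (v.adicCompletion ℚ), ∀ m' : ↥(W.geomPrimaryTorsion p),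
      (absGaloisRestrict ℚ (v.adicCompletion ℚ) σ) ^ N • m' - m' ∈ X := by
    refine ⟨2, two_pos, fun σ hσ m' ↦ ?_⟩
    obtain ⟨m, rfl⟩ : ∃ m, e m = m' := ⟨e.symm m', e.apply_symm_apply m'⟩
    set g := absGaloisRestrict ℚ (v.adicCompletion ℚ) σ with hg
    have hgI : g ∈ inertia v := Subgroup.mem_map.2 ⟨σ, hσ, rfl⟩
    rw [← apply_sq_smul_of_signEquivariant e he g m, ← map_sub, hmemX]
    have h1 := reductionDatum_htriv V p hpv hΔ g hgI (g • m)
    have h2 := reductionDatum_htriv V p hpv hΔ g hgI m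
    have h3 : g ^ 2 • m - m = (g • g • m - g • m) + (g • m - m) := by rw [pow_two, mul_smul]; abel
    rw [h3]
    exact (reductionDatum V p hpv hΔ).plus.add_mem h1 h2
  exact RamifiedOrdinaryLineUnique.eq_reductionDatum_plus W p hpv hΔ' hord' X hXdiv hXtop hXN

/-- Membership form: `e m ∈ C_p(W) ⟺ m ∈ C_p(V)`. [cite: GreenbergVatsal2000, §2 p. 26] -/
theorem apply_mem_reductionDatum_plus_iff_of_signEquivariant (hpv : ((p : ℕ) : 𝓞 ℚ) ∈ v.asIdeal)
    (hΔ : ¬ (p : ℤ) ∣ minimalDiscriminantInt V) (hΔ' : ¬ (p : ℤ) ∣ minimalDiscriminantInt W)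
    (hord : ¬ (p : ℤ) ∣ V.frobeniusTrace p) (hord' : ¬ (p : ℤ) ∣ W.frobeniusTrace p)
    (e : ↥(V.geomPrimaryTorsion p) ≃+ ↥(W.geomPrimaryTorsion p))
    (he : ∀ σ : absoluteGaloisGroup ℚ, (∀ m, e (σ • m) = σ • e m) ∨ (∀ m, e (σ • m) = -(σ • e m)))
    (m : ↥(V.geomPrimaryTorsion p)) :
    e m ∈ (reductionDatum W p hpv hΔ').plus ↔ m ∈ (reductionDatum V p hpv hΔ).plus := by
  rw [← map_reductionDatum_plus_eq_of_signEquivariant V W p hpv hΔ hΔ' hord hord' e he]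
  constructor
  · rintro ⟨m', hm', hmm'⟩
    rw [AddEquiv.coe_toAddMonoidHom, e.injective.eq_iff] at hmm'
    exact hmm' ▸ hm'
  · exact fun hm ↦ ⟨m, hm, rfl⟩

end Line

/-! ## §2 Restriction of an isomorphism of `p`-primary torsion to the `p`-torsion -/

section Restrict

variable {F : Type} [Field F] (V W : WeierstrassCurve F) (p : ℕ) [hp : Fact p.Prime]

omit hp in
/-- **An additive isomorphism `e : V[p^∞] ≃+ W[p^∞]` restricts to `ψ : V[p] ≃+ W[p]`** with `ι_W ∘ ψ = e ∘ ι_V` for the inclusions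
`ι : E[p] ↪ E[p^∞]` (`e` commutes with multiplication by `p`). [cite: SilvermanAEC2009, III.3.1(b) and III.§7] -/
theorem exists_torsionIso_of_primaryIso (e : ↥(V.geomPrimaryTorsion p) ≃+ ↥(W.geomPrimaryTorsion p)) :
    ∃ ψ : ↥(V.geomTorsion (p : ℤ)) ≃+ ↥(W.geomTorsion (p : ℤ)), ∀ t : ↥(V.geomTorsion (p : ℤ)),
      AddSubgroup.inclusion (geomTorsion_le_geomPrimaryTorsion W p) (ψ t) =
        e (AddSubgroup.inclusion (geomTorsion_le_geomPrimaryTorsion V p) t) := by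
  -- torsion membership of images
  have hmem : ∀ (e' : ↥(V.geomPrimaryTorsion p) ≃+ ↥(W.geomPrimaryTorsion p)) (t : ↥(V.geomTorsion (p : ℤ))),
      ((e' (AddSubgroup.inclusion (geomTorsion_le_geomPrimaryTorsion V p) t) : ↥(W.geomPrimaryTorsion p)) : geomPoints W) ∈
        W.geomTorsion (p : ℤ) := by
    intro e' t
    rw [mem_geomTorsion_iff, ← AddSubgroupClass.coe_zsmul, ← map_zsmul]
    have ht : (p : ℤ) • AddSubgroup.inclusion (geomTorsion_le_geomPrimaryTorsion V p) t = 0 := by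
      rw [← map_zsmul]
      have ht0 : (p : ℤ) • t = 0 := Subtype.ext (by
        rw [AddSubgroupClass.coe_zsmul, ZeroMemClass.coe_zero]; exact (mem_geomTorsion_iff V (p : ℤ) _).1 t.2)
      rw [ht0, map_zero]
    rw [ht, map_zero, ZeroMemClass.coe_zero]
  have hmem' : ∀ (e' : ↥(W.geomPrimaryTorsion p) ≃+ ↥(V.geomPrimaryTorsion p)) (t : ↥(W.geomTorsion (p : ℤ))),
      ((e' (AddSubgroup.inclusion (geomTorsion_le_geomPrimaryTorsion W p) t) : ↥(V.geomPrimaryTorsion p)) : geomPoints V) ∈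
        V.geomTorsion (p : ℤ) := by
    intro e' t
    rw [mem_geomTorsion_iff, ← AddSubgroupClass.coe_zsmul, ← map_zsmul]
    have ht : (p : ℤ) • AddSubgroup.inclusion (geomTorsion_le_geomPrimaryTorsion W p) t = 0 := by
      rw [← map_zsmul]
      have ht0 : (p : ℤ) • t = 0 := Subtype.ext (by
        rw [AddSubgroupClass.coe_zsmul, ZeroMemClass.coe_zero]; exact (mem_geomTorsion_iff W (p : ℤ) _).1 t.2)
      rw [ht0, map_zero]
    rw [ht, map_zero, ZeroMemClass.coe_zero]
  -- the inclusions as subtype re-packagings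
  have hinclV : ∀ (t : ↥(V.geomTorsion (p : ℤ))),
      AddSubgroup.inclusion (geomTorsion_le_geomPrimaryTorsion V p) t = ⟨(t : geomPoints V), geomTorsion_le_geomPrimaryTorsion V p t.2⟩ :=
    fun _ ↦ rfl
  have hinclW : ∀ (t : ↥(W.geomTorsion (p : ℤ))),
      AddSubgroup.inclusion (geomTorsion_le_geomPrimaryTorsion W p) t = ⟨(t : geomPoints W), geomTorsion_le_geomPrimaryTorsion W p t.2⟩ :=
    fun _ ↦ rfl
  refine ⟨{ toFun := fun t ↦ ⟨_, hmem e t⟩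
            invFun := fun t' ↦ ⟨_, hmem' e.symm t'⟩
            left_inv := fun t ↦ ?_
            right_inv := fun t' ↦ ?_
            map_add' := fun t₁ t₂ ↦ ?_ }, fun t ↦ ?_⟩
  · apply Subtype.ext
    have h1 : AddSubgroup.inclusion (geomTorsion_le_geomPrimaryTorsion W p) ⟨_, hmem e t⟩ =
        e (AddSubgroup.inclusion (geomTorsion_le_geomPrimaryTorsion V p) t) := Subtype.ext rfl
    change ((e.symm (AddSubgroup.inclusion (geomTorsion_le_geomPrimaryTorsion W p) ⟨_, hmem e t⟩) : ↥(V.geomPrimaryTorsion p)) :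
        geomPoints V) = t
    rw [h1, e.symm_apply_apply]
    rfl
  · apply Subtype.ext
    have h1 : AddSubgroup.inclusion (geomTorsion_le_geomPrimaryTorsion V p) ⟨_, hmem' e.symm t'⟩ =
        e.symm (AddSubgroup.inclusion (geomTorsion_le_geomPrimaryTorsion W p) t') := Subtype.ext rfl
    change ((e (AddSubgroup.inclusion (geomTorsion_le_geomPrimaryTorsion V p) ⟨_, hmem' e.symm t'⟩) : ↥(W.geomPrimaryTorsion p)) :
        geomPoints W) = t'
    rw [h1, e.apply_symm_apply]
    rfl
  · apply Subtype.ext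
    change ((e (AddSubgroup.inclusion (geomTorsion_le_geomPrimaryTorsion V p) (t₁ + t₂)) : ↥(W.geomPrimaryTorsion p)) : geomPoints W) =
      ((e (AddSubgroup.inclusion (geomTorsion_le_geomPrimaryTorsion V p) t₁) : ↥(W.geomPrimaryTorsion p)) : geomPoints W) +
        ((e (AddSubgroup.inclusion (geomTorsion_le_geomPrimaryTorsion V p) t₂) : ↥(W.geomPrimaryTorsion p)) : geomPoints W)
    rw [map_add, map_add, AddSubgroup.coe_add]
  · exact Subtype.ext rfl

end Restrict

/-! ## §3 `p = 2`: the restriction is `Γ_ℚ`-equivariant (signs are invisible on `E[2]`) and matches the `2`-adic letters -/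

section Two

variable (V W : WeierstrassCurve ℚ) [V.IsGloballyMinimal] [V.IsElliptic] [W.IsGloballyMinimal] [W.IsElliptic]
  {v : HeightOneSpectrum (𝓞 ℚ)}

omit [V.IsGloballyMinimal] [V.IsElliptic] [W.IsGloballyMinimal] [W.IsElliptic] in
/-- `-t = t` on `E[2]`. [folklore] -/
theorem neg_eq_self_geomTorsion_two (t : ↥(W.geomTorsion 2)) : -t = t := by
  rw [neg_eq_iff_add_eq_zero, ← two_zsmul]
  exact Subtype.ext (by
    rw [AddSubgroupClass.coe_zsmul, ZeroMemClass.coe_zero]; exact (mem_geomTorsion_iff W 2 _).1 t.2)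

omit [V.IsGloballyMinimal] [V.IsElliptic] [W.IsGloballyMinimal] [W.IsElliptic] in
/-- **The restriction `ψ : V[2] ≃+ W[2]` of a sign-equivariant `e : V[2^∞] ≃+ W[2^∞]` is `Γ_ℚ`-equivariant** (`−x = x` on `W[2]`).
[cite: SilvermanAEC2009, X.5 Cor. 5.4 and III.§7] -/
theorem torsionIso_smul_of_signEquivariant (e : ↥(V.geomPrimaryTorsion 2) ≃+ ↥(W.geomPrimaryTorsion 2))
    (he : ∀ σ : absoluteGaloisGroup ℚ, (∀ m, e (σ • m) = σ • e m) ∨ (∀ m, e (σ • m) = -(σ • e m)))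
    (ψ : ↥(V.geomTorsion 2) ≃+ ↥(W.geomTorsion 2))
    (hψe : ∀ t : ↥(V.geomTorsion 2), AddSubgroup.inclusion (geomTorsion_le_geomPrimaryTorsion W 2) (ψ t) =
      e (AddSubgroup.inclusion (geomTorsion_le_geomPrimaryTorsion V 2) t))
    (σ : absoluteGaloisGroup ℚ) (t : ↥(V.geomTorsion 2)) : ψ (σ • t) = σ • ψ t := by
  have hinj : Function.Injective (AddSubgroup.inclusion (geomTorsion_le_geomPrimaryTorsion W 2)) :=
    AddSubgroup.inclusion_injective _
  apply hinj
  have hincl : ∀ (s : ↥(V.geomTorsion 2)), AddSubgroup.inclusion (geomTorsion_le_geomPrimaryTorsion V 2) (σ • s) =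
      σ • AddSubgroup.inclusion (geomTorsion_le_geomPrimaryTorsion V 2) s := fun _ ↦ rfl
  have hincl' : ∀ (s : ↥(W.geomTorsion 2)), AddSubgroup.inclusion (geomTorsion_le_geomPrimaryTorsion W 2) (σ • s) =
      σ • AddSubgroup.inclusion (geomTorsion_le_geomPrimaryTorsion W 2) s := fun _ ↦ rfl
  rw [hψe, hincl, hincl', hψe]
  rcases he σ with h | h
  · exact h _
  · rw [h, ← hψe, ← hincl', ← map_neg, neg_eq_self_geomTorsion_two]

/-- **The `2`-adic letters are matched**: for data `N` on `V[2]`, `N′` on `W[2]` with `plus = C₂ ∩ E[2]` (att-p5 g10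
`RealKummerOrdinary.exists_torsionDatum`) and the restriction `ψ` of a sign-equivariant `e : V[2^∞] ≃+ W[2^∞]` between globally minimal
good ordinary curves: `t ∈ N.plus ⟺ ψ t ∈ N′.plus` (§1). [cite: GreenbergVatsal2000, §2 p. 26] [cite: GreenbergLNM1716, §5 p. 168] -/
theorem mem_plus_iff_of_signEquivariant (hpv : ((2 : ℕ) : 𝓞 ℚ) ∈ v.asIdeal)
    (hΔ : ¬ (2 : ℤ) ∣ minimalDiscriminantInt V) (hΔ' : ¬ (2 : ℤ) ∣ minimalDiscriminantInt W)
    (hord : ¬ (2 : ℤ) ∣ V.frobeniusTrace 2) (hord' : ¬ (2 : ℤ) ∣ W.frobeniusTrace 2)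
    (e : ↥(V.geomPrimaryTorsion 2) ≃+ ↥(W.geomPrimaryTorsion 2))
    (he : ∀ σ : absoluteGaloisGroup ℚ, (∀ m, e (σ • m) = σ • e m) ∨ (∀ m, e (σ • m) = -(σ • e m)))
    (ψ : ↥(V.geomTorsion 2) ≃+ ↥(W.geomTorsion 2))
    (hψe : ∀ t : ↥(V.geomTorsion 2), AddSubgroup.inclusion (geomTorsion_le_geomPrimaryTorsion W 2) (ψ t) =
      e (AddSubgroup.inclusion (geomTorsion_le_geomPrimaryTorsion V 2) t))
    (N : LocalDatum ℚ ↥(V.geomTorsion 2) v) (N' : LocalDatum ℚ ↥(W.geomTorsion 2) v)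
    (hN : ∀ t : ↥(V.geomTorsion 2), t ∈ N.plus ↔
      ((AddSubgroup.inclusion (geomTorsion_le_geomPrimaryTorsion V 2) t : ↥(V.geomPrimaryTorsion 2)) ∈ (reductionDatum V 2 hpv hΔ).plus))
    (hN' : ∀ t : ↥(W.geomTorsion 2), t ∈ N'.plus ↔
      ((AddSubgroup.inclusion (geomTorsion_le_geomPrimaryTorsion W 2) t : ↥(W.geomPrimaryTorsion 2)) ∈ (reductionDatum W 2 hpv hΔ').plus))
    (t : ↥(V.geomTorsion 2)) : t ∈ N.plus ↔ ψ t ∈ N'.plus := by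
  rw [hN, hN', hψe]
  exact (apply_mem_reductionDatum_plus_iff_of_signEquivariant V W 2 hpv hΔ hΔ' hord hord' e he _).symm

/-! ## §4 The real Kummer line along `e`: matched where `e` is equivariant, sent to the ANTI-Kummer line where it is anti-equivariant -/

omit [V.IsGloballyMinimal] [V.IsElliptic] [W.IsGloballyMinimal] [W.IsElliptic] in
/-- **The Kummer line is matched at an element where `e` is EQUIVARIANT.** If `e (g • a) = g • e a` for all `a ∈ V[2^∞]` and the
`2`-torsion points on the line `(g − 1)·V[2^∞]` are `{O, T_w}`, then the `2`-torsion points on `(g − 1)·W[2^∞]` are `{O, ψ T_w}`.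
(For the twist `W = V^{(d)}` and `g` a complex conjugation: `d > 0`.) [cite: GreenbergLNM1716, §5 Remark p. 174]
[cite: SilvermanAEC2009, X.5 Cor. 5.4] -/
theorem kummerLine_iff_of_smul_eq (e : ↥(V.geomPrimaryTorsion 2) ≃+ ↥(W.geomPrimaryTorsion 2))
    (ψ : ↥(V.geomTorsion 2) ≃+ ↥(W.geomTorsion 2))
    (hψe : ∀ t : ↥(V.geomTorsion 2), AddSubgroup.inclusion (geomTorsion_le_geomPrimaryTorsion W 2) (ψ t) =
      e (AddSubgroup.inclusion (geomTorsion_le_geomPrimaryTorsion V 2) t))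
    {g : absoluteGaloisGroup ℚ} (hg : ∀ a, e (g • a) = g • e a) {Tw : ↥(V.geomTorsion 2)}
    (hline : ∀ t : ↥(V.geomTorsion 2),
      (∃ a : ↥(V.geomPrimaryTorsion 2), g • a - a = AddSubgroup.inclusion (geomTorsion_le_geomPrimaryTorsion V 2) t) ↔ (t = 0 ∨ t = Tw))
    (t' : ↥(W.geomTorsion 2)) :
    (∃ a' : ↥(W.geomPrimaryTorsion 2), g • a' - a' = AddSubgroup.inclusion (geomTorsion_le_geomPrimaryTorsion W 2) t') ↔
      (t' = 0 ∨ t' = ψ Tw) := by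
  obtain ⟨t, rfl⟩ : ∃ t, ψ t = t' := ⟨ψ.symm t', ψ.apply_symm_apply t'⟩
  rw [EmbeddingLike.map_eq_zero_iff, ψ.injective.eq_iff, ← hline t, hψe]
  constructor
  · rintro ⟨a', ha'⟩
    refine ⟨e.symm a', e.injective ?_⟩
    rw [map_sub, hg, e.apply_symm_apply, ha']
  · rintro ⟨a, ha⟩
    exact ⟨e a, by rw [← hg, ← map_sub, ha]⟩

omit [V.IsGloballyMinimal] [V.IsElliptic] [W.IsGloballyMinimal] [W.IsElliptic] in
/-- **Where `e` is ANTI-equivariant the Kummer line goes to the ANTI-Kummer line**: if `e (g • a) = −(g • e a)` for all `a` and the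
`2`-torsion points on `(g − 1)·V[2^∞]` are `{O, T_w}`, then the `2`-torsion points on `(g + 1)·W[2^∞]` are `{O, ψ T_w}` — the image of
the Kummer letter of `V` spans the `(c + 1)`-line of `W`, not a priori its Kummer (`(c − 1)`-)line. (For the twist `W = V^{(d)}` and `g = c`
a complex conjugation: `d < 0` — the workfile's OBSERVATION «the real letter flips under negative twists» in structural form.)
[cite: GreenbergLNM1716, §5 Remark p. 174] [cite: SilvermanAEC2009, X.5 Cor. 5.4 and X.2 Prop. 2.4] -/
theorem antiKummerLine_iff_of_smul_eq_neg (e : ↥(V.geomPrimaryTorsion 2) ≃+ ↥(W.geomPrimaryTorsion 2))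
    (ψ : ↥(V.geomTorsion 2) ≃+ ↥(W.geomTorsion 2))
    (hψe : ∀ t : ↥(V.geomTorsion 2), AddSubgroup.inclusion (geomTorsion_le_geomPrimaryTorsion W 2) (ψ t) =
      e (AddSubgroup.inclusion (geomTorsion_le_geomPrimaryTorsion V 2) t))
    {g : absoluteGaloisGroup ℚ} (hg : ∀ a, e (g • a) = -(g • e a)) {Tw : ↥(V.geomTorsion 2)}
    (hline : ∀ t : ↥(V.geomTorsion 2),
      (∃ a : ↥(V.geomPrimaryTorsion 2), g • a - a = AddSubgroup.inclusion (geomTorsion_le_geomPrimaryTorsion V 2) t) ↔ (t = 0 ∨ t = Tw))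
    (t' : ↥(W.geomTorsion 2)) :
    (∃ a' : ↥(W.geomPrimaryTorsion 2), g • a' + a' = AddSubgroup.inclusion (geomTorsion_le_geomPrimaryTorsion W 2) t') ↔
      (t' = 0 ∨ t' = ψ Tw) := by
  obtain ⟨t, rfl⟩ : ∃ t, ψ t = t' := ⟨ψ.symm t', ψ.apply_symm_apply t'⟩
  rw [EmbeddingLike.map_eq_zero_iff, ψ.injective.eq_iff, ← hline t]
  -- `incl (ψ t) = -incl (ψ t)` in `W[2^∞]`
  have hneg : AddSubgroup.inclusion (geomTorsion_le_geomPrimaryTorsion W 2) (ψ t) =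
      -e (AddSubgroup.inclusion (geomTorsion_le_geomPrimaryTorsion V 2) t) := by
    rw [← hψe, ← map_neg, neg_eq_self_geomTorsion_two]
  rw [hneg]
  constructor
  · rintro ⟨a', ha'⟩
    refine ⟨e.symm a', e.injective ?_⟩
    rw [map_sub, hg, e.apply_symm_apply, ← neg_add', ha', neg_neg]
  · rintro ⟨a, ha⟩
    refine ⟨e a, ?_⟩
    rw [← ha, map_sub, hg]; abel

end Two

end Summit.BirchSwinnertonDyer.BirchSwinnertonDyer.Theorems.AlignedTransportAtTwoFineRoad.RealKummerTwistLetters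

end
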